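import Summits.KontsevichZagierPeriods.Zeta5Search.Certificates.PolyMv

/-!
# Polynomial identity testing in the kernel by one Kronecker evaluation (cell `pub-zeta5`, certifier `cert-1`)

HONEST FRAMING: systematic search; no irrationality claim unless certified.

For a reflected ring expression `e : Lean.Grind.CommRing.Expr` in the variables `v₀, v₁, v₂` we prove:
if `peval e (kronPoint e) = 0` — ONE evaluation at three (large) integers, decided by the kernel with GMP
arithmetic (`by decide +kernel`, seconds even for trees with thousands of monomials) — then `peval e [a, b, c] = 0`
in every commutative ring (`peval_eq_zero_of_kron`, `peval_eq_of_kron`). The point is the Kronecker substitution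
`v₂ := β, v₁ := β^{s₁}, v₀ := β^{s₀}` with strides `s₁ = degB 2 e + 1`, `s₀ = s₁ (degB 1 e + 1)` exceeding the
structural degree bounds of `Certificates/PolyMv.lean` and base `β = normB e + 1` exceeding the 1-norm of the integer
polynomial `toMv e`; the value is then a balanced base-`β` expansion of the coefficient vector (mixed-radix
injectivity `kIndex_inj` + digit lemma `digits_eq_zero`), which vanishes only if every coefficient does. This replaces
`Expr.toPoly` normal forms (too slow in the kernel beyond ~10³ monomials) in the replays `Certificates/VIMLevel2NK*.lean`.
General tooling; no named facts.
-/

namespace Summit.KontsevichZagierPeriods.Zeta5Search.Certificates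

namespace PolyReflect

open Lean.Grind.CommRing (Expr Var)
open MvPolynomial Finset

/-! ### Balanced digits and the Kronecker point -/

/-- **Digit lemma**: if `Σ_{i∈S} cᵢ β^{Nᵢ} = 0` with `N` injective on `S` and `Σ |cᵢ| < β`, then all `cᵢ = 0`. -/
theorem digits_eq_zero {ι : Type*} [DecidableEq ι] (N : ι → ℕ) (c : ι → ℤ) (β : ℕ) (S : Finset ι)
    (hN : Set.InjOn N S) (hsum : ∑ i ∈ S, c i * (β : ℤ) ^ N i = 0)
    (hbnd : ∑ i ∈ S, (c i).natAbs < β) : ∀ i ∈ S, c i = 0 := by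
  induction S using Finset.induction_on_max_value N with
  | empty => simp
  | insert a s has hmax ih =>
    rw [sum_insert has] at hsum hbnd
    have hinjs : Set.InjOn N s := fun x hx y hy h => hN (mem_insert_of_mem hx) (mem_insert_of_mem hy) h
    have hlt : ∀ x ∈ s, N x < N a := fun x hx =>
      lt_of_le_of_ne (hmax x hx) fun h => has ((hN (mem_insert_of_mem hx) (mem_insert_self a s) h) ▸ hx)
    -- the top digit vanishes
    have hca : c a = 0 := by
      by_contra hne
      have hβ : 1 ≤ β := by omega
      -- |c a| β^{N a} = |Σ_s …| ≤ Σ_s |c x| β^{N x} ≤ (Σ_s |c x|) β^{N a - 1}·[s ≠ ∅] < β^{N a}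
      have key : (c a).natAbs * β ^ N a ≤ (∑ x ∈ s, (c x).natAbs) * β ^ (N a - 1) := by
        have e1 : ((c a).natAbs * β ^ N a : ℕ) = (∑ x ∈ s, c x * (β : ℤ) ^ N x).natAbs := by
          have : ∑ x ∈ s, c x * (β : ℤ) ^ N x = -(c a * (β : ℤ) ^ N a) := by linear_combination hsum
          rw [this, Int.natAbs_neg, Int.natAbs_mul, Int.natAbs_pow, Int.natAbs_natCast]
        rw [e1]
        refine (Int.natAbs_sum_le _ _).trans ?_
        rw [sum_mul]
        refine sum_le_sum fun x hx => ?_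
        rw [Int.natAbs_mul, Int.natAbs_pow, Int.natAbs_natCast]
        exact Nat.mul_le_mul_left _ (Nat.pow_le_pow_right hβ (by have := hlt x hx; omega))
      have hpos : 1 ≤ (c a).natAbs := Int.natAbs_pos.mpr hne
      rcases s.eq_empty_or_nonempty with hs | hs
      · subst hs
        simp only [sum_empty, zero_mul, Nat.le_zero, mul_eq_zero] at key
        rcases key with h | h
        · exact hne (Int.natAbs_eq_zero.mp h)
        · exact pow_ne_zero _ (by omega) h
      · obtain ⟨x, hx⟩ := hs
        have hNa : 1 ≤ N a := by have := hlt x hx; omega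
        have hT : ∑ x ∈ s, (c x).natAbs < β := by omega
        have h2 : (∑ x ∈ s, (c x).natAbs) * β ^ (N a - 1) < β ^ N a :=
          calc (∑ x ∈ s, (c x).natAbs) * β ^ (N a - 1) < β * β ^ (N a - 1) :=
                mul_lt_mul_of_pos_right hT (pow_pos (by omega) _)
            _ = β ^ N a := by rw [← pow_succ', Nat.sub_add_cancel hNa]
        have h3 : β ^ N a ≤ (c a).natAbs * β ^ N a := Nat.le_mul_of_pos_left _ hpos
        omega
    intro i hi
    rcases mem_insert.mp hi with rfl | hi
    · exact hca
    · refine ih hinjs ?_ (by omega) i hi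
      simpa [hca] using hsum

/-- Mixed-radix index of an exponent vector supported on `{0,1,2}`. -/
def kIndex (s₀ s₁ : ℕ) (m : ℕ →₀ ℕ) : ℕ := m 0 * s₀ + m 1 * s₁ + m 2

/-- The Kronecker base `β = normB e + 1`. -/
def kronBase (e : Expr) : ℕ := normB e + 1
/-- The stride of `v₁`: `degB 2 e + 1`. -/
def kronS1 (e : Expr) : ℕ := degB 2 e + 1
/-- The stride of `v₀`: `(degB 2 e + 1)(degB 1 e + 1)`. -/
def kronS0 (e : Expr) : ℕ := (degB 2 e + 1) * (degB 1 e + 1)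
/-- **The Kronecker point** `[β^{s₀}, β^{s₁}, β]` of `e` (three integers). -/
def kronPoint (e : Expr) : List ℤ :=
  [((kronBase e ^ kronS0 e : ℕ) : ℤ), ((kronBase e ^ kronS1 e : ℕ) : ℤ), (kronBase e : ℤ)]

/-- Injectivity of the mixed-radix index on the degree box. -/
theorem kIndex_inj (D₁ D₂ : ℕ) {m m' : ℕ →₀ ℕ}
    (h1 : m 1 ≤ D₁) (h2 : m 2 ≤ D₂) (h1' : m' 1 ≤ D₁) (h2' : m' 2 ≤ D₂)
    (hz : ∀ i, 3 ≤ i → m i = 0) (hz' : ∀ i, 3 ≤ i → m' i = 0)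
    (h : kIndex ((D₂ + 1) * (D₁ + 1)) (D₂ + 1) m = kIndex ((D₂ + 1) * (D₁ + 1)) (D₂ + 1) m') : m = m' := by
  unfold kIndex at h
  -- N = (m0 (D₁+1) + m1) (D₂+1) + m2 : peel the mixed radix twice
  have aux : ∀ (A B r r' d : ℕ), r ≤ d → r' ≤ d → A * (d + 1) + r = B * (d + 1) + r' → A = B := by
    intro A B r r' d hr hr' h
    rcases Nat.lt_trichotomy A B with hlt | heq | hgt
    · nlinarith
    · exact heq
    · nlinarith
  have e : ∀ n : ℕ →₀ ℕ, n 0 * ((D₂ + 1) * (D₁ + 1)) + n 1 * (D₂ + 1) + n 2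
      = (n 0 * (D₁ + 1) + n 1) * (D₂ + 1) + n 2 := fun n => by ring
  rw [e m, e m'] at h
  have hq : m 0 * (D₁ + 1) + m 1 = m' 0 * (D₁ + 1) + m' 1 := aux _ _ _ _ _ h2 h2' h
  have hm2 : m 2 = m' 2 := by rw [hq] at h; exact Nat.add_left_cancel h
  have hm0 : m 0 = m' 0 := aux _ _ _ _ _ h1 h1' hq
  have hm1 : m 1 = m' 1 := by rw [hm0] at hq; exact Nat.add_left_cancel hq
  ext i
  match i with
  | 0 => exact hm0
  | 1 => exact hm1
  | 2 => exact hm2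
  | i + 3 => rw [hz (i + 3) (by omega), hz' (i + 3) (by omega)]

/-- **Main lemma**: vanishing at the Kronecker point forces `toMv e = 0`. -/
theorem toMv_eq_zero_of_kron (e : Expr) (hv : varsLT 3 e = true) (h0 : peval e (kronPoint e) = 0) :
    toMv e = 0 := by
  classical
  set p := toMv e with hp
  set β := kronBase e
  set s₁ := kronS1 e
  set s₀ := kronS0 e
  -- support facts
  have hdeg : ∀ i, ∀ m ∈ p.support, m i ≤ degB i e := fun i =>
    degreeOf_le_iff.mp (degreeOf_toMv_le i e hv)
  have hz : ∀ m ∈ p.support, ∀ i, 3 ≤ i → m i = 0 := fun m hm i hi => by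
    have := hdeg i m hm; rw [degB_eq_zero 3 i hi e hv] at this; omega
  -- the value at the Kronecker point as a digit expansion
  let v : ℕ → ℤ := fun i => (kronPoint e).getD i 0
  have hval : peval e (kronPoint e) = ∑ m ∈ p.support, p.coeff m * (β : ℤ) ^ kIndex s₀ s₁ m := by
    have h := peval_eq_eval₂_toMv e (((β ^ s₀ : ℕ) : ℤ)) (((β ^ s₁ : ℕ) : ℤ)) (β : ℤ)
    rw [kronPoint, h, show eval₂Hom (Int.castRingHom ℤ) (fun i => [((β ^ s₀ : ℕ) : ℤ), ((β ^ s₁ : ℕ) : ℤ),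
        (β : ℤ)].getD i 0) = eval (fun i => [((β ^ s₀ : ℕ) : ℤ), ((β ^ s₁ : ℕ) : ℤ), (β : ℤ)].getD i 0) from
        RingHom.ext fun q => by rw [coe_eval₂Hom, eval, coe_eval₂Hom, RingHom.ext_int (Int.castRingHom ℤ) (RingHom.id ℤ)],
      eval_eq]
    refine sum_congr rfl fun m hm => ?_
    congr 1
    rw [prod_subset (show m.support ⊆ Finset.range 3 from fun i hi => by
          rw [Finset.mem_range]; by_contra h
          exact (Finsupp.mem_support_iff.mp hi) (hz m hm i (Nat.not_lt.mp h)))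
        (fun i _ hi => by rw [Finsupp.notMem_support_iff.mp hi, pow_zero])]
    simp only [Finset.prod_range_succ, Finset.prod_range_zero, one_mul, List.getD_cons_zero, List.getD_cons_succ,
      kIndex]
    push_cast
    ring
  -- apply the digit lemma
  have hinj : Set.InjOn (kIndex s₀ s₁) p.support := fun m hm m' hm' h =>
    kIndex_inj (degB 1 e) (degB 2 e) (hdeg 1 m hm) (hdeg 2 m hm) (hdeg 1 m' hm') (hdeg 2 m' hm')
      (hz m hm) (hz m' hm') h
  have hbnd : ∑ m ∈ p.support, (p.coeff m).natAbs < β :=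
    Nat.lt_succ_of_le (L1_toMv_le e hv)
  have hall := digits_eq_zero (kIndex s₀ s₁) (fun m => p.coeff m) β p.support hinj (hval ▸ h0) hbnd
  ext m
  rw [coeff_zero]
  by_cases hm : m ∈ p.support
  · exact hall m hm
  · exact notMem_support_iff.mp hm

/-- **Kernel polynomial identity test**: an expression in `v₀,v₁,v₂` that vanishes at its Kronecker point
vanishes identically in every commutative ring. Use `(by decide +kernel)` for both hypotheses. -/
theorem peval_eq_zero_of_kron {R : Type*} [CommRing R] (e : Expr) (hv : varsLT 3 e = true)
    (h0 : peval e (kronPoint e) = 0) (a b c : R) : peval e [a, b, c] = 0 := by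
  rw [peval_eq_eval₂_toMv, toMv_eq_zero_of_kron e hv h0, map_zero]

/-- Two expressions agreeing at the Kronecker point of their difference agree identically. -/
theorem peval_eq_of_kron {R : Type*} [CommRing R] (e₁ e₂ : Expr) (hv : varsLT 3 (.sub e₁ e₂) = true)
    (h0 : peval (.sub e₁ e₂) (kronPoint (.sub e₁ e₂)) = 0) (a b c : R) : peval e₁ [a, b, c] = peval e₂ [a, b, c] := by
  have h := peval_eq_zero_of_kron (.sub e₁ e₂) hv h0 a b c
  rwa [peval_sub, sub_eq_zero] at h

/-! ### Smoke test -/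

/-- `(v₀+v₁+v₂)² − (v₀²+v₁²+v₂²+2v₀v₁+2v₀v₂+2v₁v₂) = 0` by one integer evaluation. -/
example (a b c : ℚ) : (a + b + c) ^ 2 = a ^ 2 + b ^ 2 + c ^ 2 + 2 * a * b + 2 * a * c + 2 * b * c := by
  let e₁ : Expr := .pow (.add (.add (.var 0) (.var 1)) (.var 2)) 2
  let e₂ : Expr := A (A (A (M 1 2 0 0) (M 1 0 2 0)) (A (M 1 0 0 2) (M 2 1 1 0))) (A (M 2 1 0 1) (M 2 0 1 1))
  have h := peval_eq_of_kron e₁ e₂ (by decide +kernel) (by decide +kernel) a b c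
  have d0 : pvar [a, b, c] 0 = a := rfl
  have d1 : pvar [a, b, c] 1 = b := rfl
  have d2 : pvar [a, b, c] 2 = c := rfl
  simp only [e₁, e₂, A, peval_pow, peval_add, peval_var, peval_M, d0, d1, d2] at h
  push_cast at h
  linear_combination h

end PolyReflect

end Summit.KontsevichZagierPeriods.Zeta5Search.Certificates
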